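import Mathlib
import Literature.NumberTheory.LFunctions.VanDerCorputZeta
import HarnessLib

/-!
# Weyl differencing in dichotomy form (Green–Tao 2012, Corollary 4.2), explicit

Support file (everything PROVED; no definitions, no named facts) towards the named fact
`Literature.NumberTheory.Sieve.teravainen2024_cor_2_1` (J. Teräväinen, *On the Liouville function
at polynomial arguments*, Amer. J. Math. 146 (2024) = arXiv:2010.07924, Corollary 2.1 ⊂
Theorem 2.6, proved in §5). The minor-arc case of Proposition 5.4 there (§5.4, Lemma 5.6) uses
"standard estimates for Weyl sums (see [Green–Tao, Ann. of Math. 175 (2012)])"; the second input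
of those estimates (after the linear recurrence lemma of
`LiouvillePolynomialValuesRecurrentLinear.lean`) is van der Corput's inequality in the
"dichotomy" form

> **[GT12, Corollary 4.2]** (van der Corput). Let `(a_n)_{n∈[N]}` be complex numbers with
> `|a_n| ≤ 1`, extended by zero outside `[N]`, `0 < δ < 1`, and suppose `|𝔼_{n∈[N]} a_n| ≥ δ`.
> Then for at least `δ²N/8` values of `h ∈ [N]` we have `|𝔼_{n∈[N]} a_{n+h} ā_n| ≥ δ²/8`.

This file proves it for phases `a_n = e(f(n))` on an integer interval `(a, b]` of length
`L = b - a ≥ 8/δ²`, from the tree's Weyl–van der Corput inequality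
`Literature.NumberTheory.LFunctions.VdC.vanDerCorput_e` (Graham–Kolesnik (2.3.4)):

* `Teravainen2024.card_goodShifts_ge_of_norm_sum_e_ge` — if `‖∑_{a<n≤b} e(f(n))‖ ≥ δL` then for
  at least `δ²L/16` shifts `1 ≤ d < L`, `‖∑_{a<n≤b-d} e(f(n+d) - f(n))‖ ≥ δ²L/8`.

(The printed constant `δ²N/8` for the number of shifts becomes `δ²L/16` here, as in the tree's
inequality the differenced sums run over `(a, b-d]` without wrap-around; immaterial.)

## References
* B. Green, T. Tao, Ann. of Math. 175 (2012), 465–540, Lemma 4.1 and Corollary 4.2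
  (arXiv:0709.3562, §4). [GreenTao2012Nilmanifolds]
* J. Teräväinen, Amer. J. Math. 146 (2024), §5.4, proof of Lemma 5.6. [Teravainen2024]
-/

noncomputable section

open Finset

namespace Literature.NumberTheory.Sieve

namespace Teravainen2024

open Literature.NumberTheory.LFunctions

/-- **Green–Tao 2012, Corollary 4.2 (van der Corput, dichotomy form), explicit.** Let
`f : ℝ → ℝ`, `a < b` integers with `L = b - a ≥ 8/δ²`, `0 < δ ≤ 1`, and suppose
`‖∑_{a<n≤b} e(f(n))‖ ≥ δ L`. Then
`#{1 ≤ d < L : ‖∑_{a<n≤b-d} e(f(n+d) - f(n))‖ ≥ δ²L/8} ≥ δ²L/16`.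
[cite: GreenTao2012Nilmanifolds, Corollary 4.2 (explicit variant)]
[cite: Teravainen2024, §5.4 (Lemma 5.6, "standard estimates for Weyl sums")] -/
theorem card_goodShifts_ge_of_norm_sum_e_ge (f : ℝ → ℝ) {a b : ℤ} {δ : ℝ} (hδ0 : 0 < δ)
    (hδ1 : δ ≤ 1) (hL : 8 / δ ^ 2 ≤ ((b - a : ℤ) : ℝ))
    (hS : δ * ((b - a : ℤ) : ℝ) ≤ ‖∑ n ∈ Finset.Ioc a b, VdC.e (f n)‖) :
    δ ^ 2 * ((b - a : ℤ) : ℝ) / 16 ≤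
      #((Finset.Ico (1 : ℤ) (b - a)).filter fun d =>
        δ ^ 2 * ((b - a : ℤ) : ℝ) / 8 ≤
          ‖∑ n ∈ Finset.Ioc a (b - d), VdC.e (f ((n + d : ℤ)) - f n)‖) := by
  classical
  set L : ℝ := ((b - a : ℤ) : ℝ) with hLdef
  have hδ2 : 0 < δ ^ 2 := by positivity
  have hδ21 : δ ^ 2 ≤ 1 := by nlinarith
  have hL8 : 8 ≤ L := by
    have : (8 : ℝ) ≤ 8 / δ ^ 2 := by
      rw [le_div_iff₀ hδ2]
      nlinarith
    linarith
  have hLpos : 0 < L := by linarith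
  have hab : a < b := by
    have h0 : (0 : ℝ) < ((b - a : ℤ) : ℝ) := hLpos
    have h1 : (0 : ℤ) < b - a := by exact_mod_cast h0
    omega
  -- the tree's Weyl–van der Corput inequality with `H = L`
  set H : ℕ := (b - a).toNat with hH
  have hHZ : (H : ℤ) = b - a := Int.toNat_of_nonneg (by omega)
  have hHR : (H : ℝ) = L := by
    rw [hLdef]
    exact_mod_cast hHZ
  have hH1 : 1 ≤ H := by omega
  have hvdc := VdC.vanDerCorput_e f (a := a) (b := b) hH1 (le_of_eq hHZ)
  -- notation for the differenced sums
  set C : ℤ → ℝ := fun d => ‖∑ n ∈ Finset.Ioc a (b - d), VdC.e (f ((n + d : ℤ)) - f n)‖ with hC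
  have hC0 : ∀ d, 0 ≤ C d := fun d => norm_nonneg _
  have hCle : ∀ d ∈ Finset.Ico (1 : ℤ) (b - a), C d ≤ L := by
    intro d hd
    rw [Finset.mem_Ico] at hd
    simp only [hC]
    refine (norm_sum_le _ _).trans ?_
    calc ∑ n ∈ Finset.Ioc a (b - d), ‖VdC.e (f ((n + d : ℤ)) - f n)‖
        = ∑ n ∈ Finset.Ioc a (b - d), (1 : ℝ) := by
          refine Finset.sum_congr rfl fun n _ => ?_
          rw [VdC.norm_e]
      _ = #(Finset.Ioc a (b - d)) := by simp
      _ ≤ L := by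
          rw [Int.card_Ioc, hLdef]
          have h1 : ((b - d - a).toNat : ℤ) ≤ b - a := by
            rw [Int.toNat_of_nonneg (by omega)]
            omega
          exact_mod_cast h1
  -- rewrite the van der Corput bound: `δ² L² ≤ 2L + 4 ∑ C d`
  have hsumC : ∑ d ∈ Finset.Ico (1 : ℤ) H, ‖∑ n ∈ Finset.Ioc a (b - d),
      VdC.e (f ((n + d : ℤ)) - f n)‖ = ∑ d ∈ Finset.Ico (1 : ℤ) (b - a), C d := by
    rw [hHZ]
  rw [hsumC, hHR] at hvdc
  have hbasic : δ ^ 2 * L ^ 2 ≤ 2 * L + 4 * ∑ d ∈ Finset.Ico (1 : ℤ) (b - a), C d := by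
    have h1 : (δ * L) ^ 2 ≤ ‖∑ n ∈ Finset.Ioc a b, VdC.e (f n)‖ ^ 2 :=
      pow_le_pow_left₀ (by positivity) hS 2
    have h2 : ((b : ℝ) - a) = L := by rw [hLdef]; push_cast; ring
    rw [h2] at hvdc
    have h3 : 2 * L ^ 2 / L + 4 * L / L * ∑ d ∈ Finset.Ico (1 : ℤ) (b - a), C d =
        2 * L + 4 * ∑ d ∈ Finset.Ico (1 : ℤ) (b - a), C d := by
      field_simp
    rw [h3] at hvdc
    calc δ ^ 2 * L ^ 2 = (δ * L) ^ 2 := by ring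
      _ ≤ _ := h1.trans hvdc
  -- split the sum into good and bad shifts
  set G : Finset ℤ := (Finset.Ico (1 : ℤ) (b - a)).filter fun d => δ ^ 2 * L / 8 ≤ C d with hG
  have hsplit : ∑ d ∈ Finset.Ico (1 : ℤ) (b - a), C d ≤ #G * L + L * (δ ^ 2 * L / 8) := by
    rw [← Finset.sum_filter_add_sum_filter_not (Finset.Ico (1 : ℤ) (b - a))
      (fun d => δ ^ 2 * L / 8 ≤ C d)]
    have h1 : ∑ d ∈ (Finset.Ico (1 : ℤ) (b - a)).filter (fun d => δ ^ 2 * L / 8 ≤ C d), C d ≤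
        #G * L := by
      calc ∑ d ∈ (Finset.Ico (1 : ℤ) (b - a)).filter (fun d => δ ^ 2 * L / 8 ≤ C d), C d
          ≤ ∑ d ∈ (Finset.Ico (1 : ℤ) (b - a)).filter (fun d => δ ^ 2 * L / 8 ≤ C d), L :=
            Finset.sum_le_sum fun d hd => hCle d (Finset.mem_filter.mp hd).1
        _ = #G * L := by rw [Finset.sum_const, nsmul_eq_mul]
    have h2 : ∑ d ∈ (Finset.Ico (1 : ℤ) (b - a)).filter (fun d => ¬ δ ^ 2 * L / 8 ≤ C d), C d ≤
        L * (δ ^ 2 * L / 8) := by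
      calc ∑ d ∈ (Finset.Ico (1 : ℤ) (b - a)).filter (fun d => ¬ δ ^ 2 * L / 8 ≤ C d), C d
          ≤ ∑ d ∈ (Finset.Ico (1 : ℤ) (b - a)).filter (fun d => ¬ δ ^ 2 * L / 8 ≤ C d),
              δ ^ 2 * L / 8 :=
            Finset.sum_le_sum fun d hd => (not_le.mp (Finset.mem_filter.mp hd).2).le
        _ = #((Finset.Ico (1 : ℤ) (b - a)).filter (fun d => ¬ δ ^ 2 * L / 8 ≤ C d)) *
              (δ ^ 2 * L / 8) := by rw [Finset.sum_const, nsmul_eq_mul]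
        _ ≤ L * (δ ^ 2 * L / 8) := by
            apply mul_le_mul_of_nonneg_right _ (by positivity)
            calc (#((Finset.Ico (1 : ℤ) (b - a)).filter (fun d => ¬ δ ^ 2 * L / 8 ≤ C d)) : ℝ)
                ≤ #(Finset.Ico (1 : ℤ) (b - a)) := by
                  exact_mod_cast Finset.card_le_card (Finset.filter_subset _ _)
              _ ≤ L := by
                  rw [Int.card_Ico, hLdef]
                  have h1 : ((b - a - 1).toNat : ℤ) ≤ b - a := by
                    rw [Int.toNat_of_nonneg (by omega)]
                    omega
                  exact_mod_cast h1
    linarith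
  -- conclude: `δ² L ≤ 2 + 4 #G + δ² L / 2`, so `#G ≥ δ² L/8 - 1/2 ≥ δ² L/16`
  have hmain : δ ^ 2 * L ^ 2 ≤ 2 * L + 4 * (#G * L) + δ ^ 2 * L ^ 2 / 2 := by nlinarith
  have hdiv : δ ^ 2 * L ≤ 2 + 4 * #G + δ ^ 2 * L / 2 := by
    have h := div_le_div_of_nonneg_right hmain hLpos.le
    have e1 : δ ^ 2 * L ^ 2 / L = δ ^ 2 * L := by field_simp
    have e2 : (2 * L + 4 * (#G * L) + δ ^ 2 * L ^ 2 / 2) / L = 2 + 4 * #G + δ ^ 2 * L / 2 := by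
      field_simp
    rw [e1, e2] at h
    exact h
  have hL16 : 1 / 2 ≤ δ ^ 2 * L / 16 := by
    have : 8 ≤ δ ^ 2 * L := by
      have := mul_le_mul_of_nonneg_left hL hδ2.le
      rw [mul_div_cancel₀ _ hδ2.ne'] at this
      rw [hLdef]
      exact this
    linarith
  have hGeq : (#G : ℝ) = #((Finset.Ico (1 : ℤ) (b - a)).filter fun d =>
      δ ^ 2 * ((b - a : ℤ) : ℝ) / 8 ≤
        ‖∑ n ∈ Finset.Ioc a (b - d), VdC.e (f ((n + d : ℤ)) - f n)‖) := by
    rw [hG]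
  rw [← hGeq]
  linarith

end Teravainen2024

end Literature.NumberTheory.Sieve
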